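import Mathlib
import HarnessLib
import Summits.HubbardSuperconductivity.HubbardSuperconductivity.Theorems.KLProgrammeC4aCompositeJetCounting

/-!
# Route `KLProgramme` — crux C4a, S3 brick (B4, DIRECT SHEET): ENVELOPE PRESERVATION — under band-distance control of the co-moving jets of the
# partner band, every base-angle derivative of the partner propagator keeps the propagator's own envelope

Cell `gate-hubbard-kl`, seat hubbard-kl-k3c3-p3 (g25; row «implicit-function / monotonicity route for μ(n)»).  Located brick «(B4)-DIRECT-COUNT», the
power-counting step, for the (C)-closer lane hubbard-kl-c4a-1 (stub (C) `stub_twoLeg_curvature` of `KLRegimeEngineV17F2`, stmt-HubbardSuperconductivity-20437;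
memo HOME/hubbard-kl-c4a-1/C4A-PLAN.md §24.4–§24.6 (B4), HOME/hubbard-kl-k3c3-p3/B4-DIRECT-COUNT.md §2).  Carrier-free sequel of `…C4aCompositeJetCounting`
(Faà di Bruno with one small factor per block) and companion of `…C4aTwoNodeControl` (which supplies the small factor in the BAND-DISTANCE form).

THE STEP.  Let `Ψ` be a propagator-like profile with the scale-`m` ENVELOPE `‖Ψ^{(L)}(u)‖ ≤ P_L / max(m,|u|)^{L+1}` (`m > 0`: for the ultraviolet symbol
above scale `Λ` at frequency `ω̄`, `m = max(|ω̄|, Λ/2)`; for a single shell, `m ≍` the shell scale), and let the inner function `g = ē(·)` (the partner band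
along the base angle) have jets controlled by the band distances, `|g^{(j)}(x)| ≤ C·(s + |g(x)|)·G_j` with `G_j ≤ Dʲ` (`s = |e| + |ρ|`: the loop level and
the tube offset; `…C4aTwoNodeControl`).  Then (`norm_iteratedDeriv_scomp_le_envelope`)

  `‖∂ⁿ_θ Ψ(g(θ))‖ ≤ n!·Dⁿ·(Σ_{L=1}^{n} P_L·C^L) · (1 + s/max(m,|g|))ⁿ / max(m,|g|)`,

i.e. the `n`-th jet has the envelope `1/max(m,|ē|)` of `Ψ(ē)` itself, times `(1 + (|e|+|ρ|)/max(m,|ē|))ⁿ` — which is `≤ 2ⁿ` whenever the partner's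
scale dominates the loop level and the tube offset (`|e| + |ρ| ≤ max(m,|ē|)`: the partner is the COARSER line of the shell pair and the tube is a slice tube).
No integration by parts and no case analysis (Cooper / tangency / generic) enters: on the direct sheet every base-angle derivative is paid by the scale of
the line it falls on (`norm_iteratedDeriv_scomp_le_envelope_of_coarser`).  With the Jacobian weight (Leibniz layer of `…C4aCompositeJetCounting`):
`norm_iteratedDeriv_weight_smul_scomp_le_envelope`.  The algebra is `pow_band_distance_div_envelope_le`:
`(C(s+|u|))^L / max(m,|u|)^{L+1} ≤ C^L·(1 + s/max(m,|u|))^L / max(m,|u|)`.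

Pure calculus; nothing about the Hubbard model's sizes; nothing asserts (C), K3 or superconductivity.  References: FST II = Feldman–Salmhofer–Trubowitz
CPAM 51 (1998) §3; BGM 2006 §2.4, §3 (2.36aa) [cite: BenfattoGiulianiMastropietro2006].
-/

noncomputable section

namespace Summit.HubbardSuperconductivity.HubbardSuperconductivity.Theorems.C4a

set_option linter.dupNamespace false -- summit = problem name (single-conjunct summit), D-0017

open Real Finset

/-! ## §1 The algebra of the band-distance small factor against the envelope -/

/-- `(s + |u|)/max(m,|u|) ≤ 1 + s/max(m,|u|)` (`|u| ≤ max(m,|u|)`). -/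
theorem add_abs_div_envelope_le {m s u : ℝ} (hm : 0 < m) : (s + |u|) / max m |u| ≤ 1 + s / max m |u| := by
  have hM : 0 < max m |u| := lt_max_of_lt_left hm
  rw [add_div]
  have h1 : |u| / max m |u| ≤ 1 := (div_le_one hM).2 (le_max_right _ _)
  linarith

/-- **The small factor against the envelope**: `(C(s+|u|))^L / max(m,|u|)^{L+1} ≤ C^L·(1 + s/max(m,|u|))^L / max(m,|u|)` (`C, s ≥ 0`, `m > 0`). -/
theorem pow_band_distance_div_envelope_le {m s u C : ℝ} (hm : 0 < m) (hs : 0 ≤ s) (hC : 0 ≤ C) (L : ℕ) :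
    (C * (s + |u|)) ^ L / max m |u| ^ (L + 1) ≤ C ^ L * (1 + s / max m |u|) ^ L / max m |u| := by
  have hM : 0 < max m |u| := lt_max_of_lt_left hm
  have hq : 0 ≤ (s + |u|) / max m |u| := div_nonneg (add_nonneg hs (abs_nonneg u)) hM.le
  have key : (C * (s + |u|)) ^ L / max m |u| ^ (L + 1) = C ^ L * ((s + |u|) / max m |u|) ^ L / max m |u| := by
    rw [mul_pow, div_pow, pow_succ]
    field_simp
  rw [key]
  exact div_le_div_of_nonneg_right (mul_le_mul_of_nonneg_left (pow_le_pow_left₀ hq (add_abs_div_envelope_le hm) L) (pow_nonneg hC L)) hM.le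

/-- Monotonicity of the loss factor in the order: `(1 + s/max(m,|u|))^L ≤ (1 + s/max(m,|u|))^n` for `L ≤ n` (`s ≥ 0`). -/
theorem one_add_div_envelope_pow_mono {m s u : ℝ} (hm : 0 < m) (hs : 0 ≤ s) {L n : ℕ} (hLn : L ≤ n) :
    (1 + s / max m |u|) ^ L ≤ (1 + s / max m |u|) ^ n := by
  have hM : 0 < max m |u| := lt_max_of_lt_left hm
  exact pow_le_pow_right₀ (le_add_of_nonneg_right (div_nonneg hs hM.le)) hLn

/-- The loss factor is at most `2` when the partner scale dominates: `s ≤ max(m,|u|)` ⇒ `1 + s/max(m,|u|) ≤ 2`. -/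
theorem one_add_div_envelope_le_two {m s u : ℝ} (hm : 0 < m) (hsm : s ≤ max m |u|) : 1 + s / max m |u| ≤ 2 := by
  have hM : 0 < max m |u| := lt_max_of_lt_left hm
  have : s / max m |u| ≤ 1 := (div_le_one hM).2 hsm
  linarith

/-! ## §2 Envelope preservation for the composite `Ψ ∘ g` -/

section Composite

variable {E : Type*} [NormedAddCommGroup E] [NormedSpace ℝ E]

/-- **ENVELOPE PRESERVATION.**  `Ψ` with the scale-`m` envelope `‖Ψ^{(L)}(g x)‖ ≤ P_L/max(m,|g x|)^{L+1}` (`1 ≤ L ≤ n`), inner jets controlled by the band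
distances `|g^{(j)}(x)| ≤ C·(s + |g x|)·G_j` with `0 ≤ G_j ≤ Dʲ` (`1 ≤ j ≤ n`), `C, s, D ≥ 0`, `m > 0`, `1 ≤ n`:
`‖∂ⁿ(Ψ∘g)(x)‖ ≤ n!·Dⁿ·(Σ_{L=1}^{n} P_L·C^L)·(1 + s/max(m,|g x|))ⁿ / max(m,|g x|)`. -/
theorem norm_iteratedDeriv_scomp_le_envelope {Ψ : ℝ → E} {g : ℝ → ℝ} {x : ℝ} {n : ℕ} (hn : 1 ≤ n)
    (hΨ : ContDiffAt ℝ n Ψ (g x)) (hg : ContDiffAt ℝ n g x) {m : ℝ} (hm : 0 < m) {P : ℕ → ℝ} (hP0 : ∀ L, 1 ≤ L → L ≤ n → 0 ≤ P L)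
    (hP : ∀ L, 1 ≤ L → L ≤ n → ‖iteratedDeriv L Ψ (g x)‖ ≤ P L / max m |g x| ^ (L + 1))
    {C s D : ℝ} (hC : 0 ≤ C) (hs : 0 ≤ s) (hD : 0 ≤ D) {G : ℕ → ℝ}
    (hG : ∀ j, 1 ≤ j → j ≤ n → |iteratedDeriv j g x| ≤ C * (s + |g x|) * G j) (hG0 : ∀ j, 1 ≤ j → j ≤ n → 0 ≤ G j)
    (hGD : ∀ j, 1 ≤ j → j ≤ n → G j ≤ D ^ j) :
    ‖iteratedDeriv n (fun θ => Ψ (g θ)) x‖ ≤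
      (n.factorial : ℝ) * D ^ n * (∑ L ∈ Icc 1 n, P L * C ^ L) * (1 + s / max m |g x|) ^ n / max m |g x| := by
  have hM : 0 < max m |g x| := lt_max_of_lt_left hm
  have hα : 0 ≤ C * (s + |g x|) := mul_nonneg hC (add_nonneg hs (abs_nonneg _))
  have h1 := norm_iteratedDeriv_scomp_le_factorial hn hΨ hg hα hD (M := fun L => P L / max m |g x| ^ (L + 1)) hP hG hG0 hGD
  refine h1.trans ?_
  -- termwise: `P_L/max^{L+1}·(C(s+|u|))^L ≤ P_L·C^L·(1+s/max)^n/max`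
  have hterm : ∀ L ∈ Icc 1 n, P L / max m |g x| ^ (L + 1) * (C * (s + |g x|)) ^ L ≤
      P L * C ^ L * ((1 + s / max m |g x|) ^ n / max m |g x|) := by
    intro L hL
    have hL' := Finset.mem_Icc.1 hL
    have e1 : P L / max m |g x| ^ (L + 1) * (C * (s + |g x|)) ^ L = P L * ((C * (s + |g x|)) ^ L / max m |g x| ^ (L + 1)) := by
      rw [div_mul_eq_mul_div, mul_div_assoc]
    rw [e1, mul_assoc]
    refine mul_le_mul_of_nonneg_left ?_ (hP0 L hL'.1 hL'.2)
    refine (pow_band_distance_div_envelope_le hm hs hC L).trans ?_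
    rw [mul_div_assoc]
    exact mul_le_mul_of_nonneg_left (div_le_div_of_nonneg_right (one_add_div_envelope_pow_mono hm hs hL'.2) hM.le) (pow_nonneg hC L)
  have hsum : ∑ L ∈ Icc 1 n, P L / max m |g x| ^ (L + 1) * (C * (s + |g x|)) ^ L ≤
      (∑ L ∈ Icc 1 n, P L * C ^ L) * ((1 + s / max m |g x|) ^ n / max m |g x|) := by
    rw [Finset.sum_mul]; exact Finset.sum_le_sum hterm
  have hpre : 0 ≤ (n.factorial : ℝ) * D ^ n := by positivity
  calc (n.factorial : ℝ) * D ^ n * ∑ L ∈ Icc 1 n, P L / max m |g x| ^ (L + 1) * (C * (s + |g x|)) ^ L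
      ≤ (n.factorial : ℝ) * D ^ n * ((∑ L ∈ Icc 1 n, P L * C ^ L) * ((1 + s / max m |g x|) ^ n / max m |g x|)) :=
        mul_le_mul_of_nonneg_left hsum hpre
    _ = _ := by ring

/-- **… WHEN THE PARTNER IS THE COARSER LINE** (`s ≤ max(m,|g x|)`): `‖∂ⁿ(Ψ∘g)(x)‖ ≤ n!·(2D)ⁿ·(Σ_{L=1}^{n} P_L·C^L) / max(m,|g x|)` — the `n`-th
base-angle jet of the partner propagator has the envelope of the propagator itself, with an `n`-dependent but SCALE-FREE constant. -/
theorem norm_iteratedDeriv_scomp_le_envelope_of_coarser {Ψ : ℝ → E} {g : ℝ → ℝ} {x : ℝ} {n : ℕ} (hn : 1 ≤ n)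
    (hΨ : ContDiffAt ℝ n Ψ (g x)) (hg : ContDiffAt ℝ n g x) {m : ℝ} (hm : 0 < m) {P : ℕ → ℝ} (hP0 : ∀ L, 1 ≤ L → L ≤ n → 0 ≤ P L)
    (hP : ∀ L, 1 ≤ L → L ≤ n → ‖iteratedDeriv L Ψ (g x)‖ ≤ P L / max m |g x| ^ (L + 1))
    {C s D : ℝ} (hC : 0 ≤ C) (hs : 0 ≤ s) (hD : 0 ≤ D) {G : ℕ → ℝ}
    (hG : ∀ j, 1 ≤ j → j ≤ n → |iteratedDeriv j g x| ≤ C * (s + |g x|) * G j) (hG0 : ∀ j, 1 ≤ j → j ≤ n → 0 ≤ G j)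
    (hGD : ∀ j, 1 ≤ j → j ≤ n → G j ≤ D ^ j) (hsm : s ≤ max m |g x|) :
    ‖iteratedDeriv n (fun θ => Ψ (g θ)) x‖ ≤ (n.factorial : ℝ) * (2 * D) ^ n * (∑ L ∈ Icc 1 n, P L * C ^ L) / max m |g x| := by
  have hM : 0 < max m |g x| := lt_max_of_lt_left hm
  refine (norm_iteratedDeriv_scomp_le_envelope hn hΨ hg hm hP0 hP hC hs hD hG hG0 hGD).trans ?_
  have hS : 0 ≤ ∑ L ∈ Icc 1 n, P L * C ^ L :=
    Finset.sum_nonneg fun L hL => mul_nonneg (hP0 L (Finset.mem_Icc.1 hL).1 (Finset.mem_Icc.1 hL).2) (pow_nonneg hC L)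
  have h2 : (1 + s / max m |g x|) ^ n ≤ 2 ^ n :=
    pow_le_pow_left₀ (by positivity) (one_add_div_envelope_le_two hm hsm) n
  rw [mul_pow]
  have hpre : 0 ≤ (n.factorial : ℝ) * D ^ n * ∑ L ∈ Icc 1 n, P L * C ^ L := by positivity
  calc (n.factorial : ℝ) * D ^ n * (∑ L ∈ Icc 1 n, P L * C ^ L) * (1 + s / max m |g x|) ^ n / max m |g x|
      ≤ (n.factorial : ℝ) * D ^ n * (∑ L ∈ Icc 1 n, P L * C ^ L) * 2 ^ n / max m |g x| :=
        div_le_div_of_nonneg_right (mul_le_mul_of_nonneg_left h2 hpre) hM.le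
    _ = _ := by ring

/-- **ENVELOPE PRESERVATION WITH THE JACOBIAN WEIGHT** (Leibniz layer): with a Jacobian table `|∂ᵃJ| ≤ Jt a` (`a ≤ n`) and the value envelope
`‖Ψ(g x)‖ ≤ P₀/max(m,|g x|)` in addition,
`‖∂ⁿ_θ (J(φ+θ)•Ψ(g θ))(x)‖ ≤ [Jt n·P₀ + Σ_{a<n} C(n,a)·Jt a·(n−a)!·D^{n−a}·(Σ_{L=1}^{n−a} P_L C^L)·(1 + s/max)^{n−a}] / max(m,|g x|)`. -/
theorem norm_iteratedDeriv_weight_smul_scomp_le_envelope {J : ℝ → ℝ} {Ψ : ℝ → E} {g : ℝ → ℝ} {n : ℕ}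
    (hJ : ContDiff ℝ n J) (hΨ : ContDiff ℝ n Ψ) (hg : ContDiff ℝ n g)
    {Jt : ℕ → ℝ} (hJt : ∀ a ≤ n, ∀ s, |iteratedDeriv a J s| ≤ Jt a) {m : ℝ} (hm : 0 < m) {x : ℝ} {P : ℕ → ℝ} (hP0 : ∀ L ≤ n, 0 ≤ P L)
    (hP : ∀ L ≤ n, ‖iteratedDeriv L Ψ (g x)‖ ≤ P L / max m |g x| ^ (L + 1))
    {C s D : ℝ} (hC : 0 ≤ C) (hs : 0 ≤ s) (hD : 0 ≤ D) {G : ℕ → ℝ}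
    (hG : ∀ j, 1 ≤ j → j ≤ n → |iteratedDeriv j g x| ≤ C * (s + |g x|) * G j) (hG0 : ∀ j, 1 ≤ j → j ≤ n → 0 ≤ G j)
    (hGD : ∀ j, 1 ≤ j → j ≤ n → G j ≤ D ^ j) (φ : ℝ) :
    ‖iteratedDeriv n (fun θ => J (φ + θ) • Ψ (g θ)) x‖ ≤
      (Jt n * P 0 + ∑ a ∈ Finset.range n, (n.choose a : ℝ) * Jt a *
        (((n - a).factorial : ℝ) * D ^ (n - a) * (∑ L ∈ Icc 1 (n - a), P L * C ^ L) * (1 + s / max m |g x|) ^ (n - a))) / max m |g x| := by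
  have hM : 0 < max m |g x| := lt_max_of_lt_left hm
  have hα : 0 ≤ C * (s + |g x|) := mul_nonneg hC (add_nonneg hs (abs_nonneg _))
  have h1 := norm_iteratedDeriv_weight_smul_scomp_le_factorial hJ hΨ hg hJt hα hD (M := fun L => P L / max m |g x| ^ (L + 1)) hP hG hG0 hGD φ
  refine h1.trans ?_
  have hJt0 : ∀ a ≤ n, 0 ≤ Jt a := fun a ha => (abs_nonneg _).trans (hJt a ha 0)
  -- value term
  have hval : Jt n * (P 0 / max m |g x| ^ (0 + 1)) = Jt n * P 0 / max m |g x| := by rw [zero_add, pow_one, mul_div_assoc]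
  -- each Leibniz term
  have hterm : ∀ a ∈ Finset.range n, (n.choose a : ℝ) * Jt a *
      (((n - a).factorial : ℝ) * D ^ (n - a) * ∑ L ∈ Icc 1 (n - a), P L / max m |g x| ^ (L + 1) * (C * (s + |g x|)) ^ L) ≤
      (n.choose a : ℝ) * Jt a *
      (((n - a).factorial : ℝ) * D ^ (n - a) * (∑ L ∈ Icc 1 (n - a), P L * C ^ L) * (1 + s / max m |g x|) ^ (n - a)) / max m |g x| := by
    intro a ha
    have ha' : a < n := Finset.mem_range.1 ha
    have hsub : ∀ L ∈ Icc 1 (n - a), P L / max m |g x| ^ (L + 1) * (C * (s + |g x|)) ^ L ≤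
        P L * C ^ L * ((1 + s / max m |g x|) ^ (n - a) / max m |g x|) := by
      intro L hL
      have hL' := Finset.mem_Icc.1 hL
      have hLn : L ≤ n := hL'.2.trans (Nat.sub_le n a)
      have e1 : P L / max m |g x| ^ (L + 1) * (C * (s + |g x|)) ^ L = P L * ((C * (s + |g x|)) ^ L / max m |g x| ^ (L + 1)) := by
        rw [div_mul_eq_mul_div, mul_div_assoc]
      rw [e1, mul_assoc]
      refine mul_le_mul_of_nonneg_left ?_ (hP0 L hLn)
      refine (pow_band_distance_div_envelope_le hm hs hC L).trans ?_
      rw [mul_div_assoc]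
      exact mul_le_mul_of_nonneg_left (div_le_div_of_nonneg_right (one_add_div_envelope_pow_mono hm hs hL'.2) hM.le) (pow_nonneg hC L)
    have hsum : ∑ L ∈ Icc 1 (n - a), P L / max m |g x| ^ (L + 1) * (C * (s + |g x|)) ^ L ≤
        (∑ L ∈ Icc 1 (n - a), P L * C ^ L) * ((1 + s / max m |g x|) ^ (n - a) / max m |g x|) := by
      rw [Finset.sum_mul]; exact Finset.sum_le_sum hsub
    have hpre : 0 ≤ (n.choose a : ℝ) * Jt a * (((n - a).factorial : ℝ) * D ^ (n - a)) := by
      have := hJt0 a ha'.le; positivity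
    calc (n.choose a : ℝ) * Jt a * (((n - a).factorial : ℝ) * D ^ (n - a) * ∑ L ∈ Icc 1 (n - a), P L / max m |g x| ^ (L + 1) * (C * (s + |g x|)) ^ L)
        = (n.choose a : ℝ) * Jt a * (((n - a).factorial : ℝ) * D ^ (n - a)) *
            ∑ L ∈ Icc 1 (n - a), P L / max m |g x| ^ (L + 1) * (C * (s + |g x|)) ^ L := by ring
      _ ≤ (n.choose a : ℝ) * Jt a * (((n - a).factorial : ℝ) * D ^ (n - a)) *
            ((∑ L ∈ Icc 1 (n - a), P L * C ^ L) * ((1 + s / max m |g x|) ^ (n - a) / max m |g x|)) :=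
          mul_le_mul_of_nonneg_left hsum hpre
      _ = _ := by ring
  rw [hval, add_div, Finset.sum_div]
  exact add_le_add le_rfl (Finset.sum_le_sum hterm)

end Composite

end Summit.HubbardSuperconductivity.HubbardSuperconductivity.Theorems.C4a

end
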